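import Mathlib
import Summits.KontsevichZagierPeriods.KontsevichZagierPeriods.Theorems.SoloInformedQShWords
import Summits.KontsevichZagierPeriods.KontsevichZagierPeriods.Theorems.SoloInformedHarmonicGQ
import HarnessLib
import HarnessLib.Audit

/-!
# SoloInformed — the two-chain identity `G(Q)·G(R) = Σ_w G(chain_w)` (PROGRAMME XLVII, file 2)

Solo programme `solo-KontsevichZagierPeriods-informed`, session s47.

For two chains `Q = (Q₀,…,Q_K)`, `R = (R₀,…,R_J)` of numbers in `[0,1)` (in the application: the
prefix products of the cube at the block ends of two indices `u`, `v`, living on disjoint sets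
of coordinates) and a quasi-shuffle word `w ∈ QSh (K+1) (J+1)`, the CHAIN OF `w` lists, step
by step, the product (value of `Q` consumed so far) · (value of `R` consumed so far)
(`soloInformedChainW`, structural in `w` with consumption counters; `soloInformedQV Q 0 = 1`).
With the chain function `G` of file `SoloInformedHarmonicGQ` and the OPEN product
`G°(c) = ∏ c_t/(1−c_t)` (`soloInformedGO`):

* `Σ_{w ∈ QSh K J} G°(chain_w) = G°(Q)·G°(R)`  (`soloInformed_sum_GO_chainW`) — by recursion on
  the LAST step: every word ends with the entry `Q_K R_J`, and
  `(1 + Q/(1−Q) + R/(1−R)) · QR/(1−QR) = Q/(1−Q) · R/(1−R)`;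
* **the two-chain identity** `Σ_{w ∈ QSh (K+1) (J+1)} G(chain_w) = G(Q)·G(R)`
  (`soloInformed_sum_GQ_chainW`), since `G(c) = G°(init c)/(1 − last c)`.

This is the rational-function form of Hoffman's harmonic product of nested sums
(`Σ_{n} a^n · Σ_{n'} b^{n'} = Σ_{quasi-shuffles}`), proved here without series. The entry formula
`soloInformed_chainW_eq_ofFn` (entries as products indexed by prefix counts) is what the cube
side (files 3–4) matches.

References: Hoffman 1997 §2; Hoffman 2000 §2; Zudilin 2003 §1 (nested-sum form).
-/

noncomputable section

open Finset

namespace Summit.KontsevichZagierPeriods.KontsevichZagierPeriods.Theorems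

open SoloInformedQStep

/-! ## 1. Values, chains, the open product -/

/-- Value of a chain after consuming `n` blocks: `1` if none, else the `(n−1)`-st entry. -/
def soloInformedQV (Q : List ℝ) : ℕ → ℝ
  | 0 => 1
  | n + 1 => Q.getD n 0

/-- `QV Q 0 = 1`. -/
@[simp] theorem soloInformedQV_zero (Q : List ℝ) : soloInformedQV Q 0 = 1 := rfl

/-- `QV Q (n+1) = Q[n]`. -/
@[simp] theorem soloInformedQV_succ (Q : List ℝ) (n : ℕ) : soloInformedQV Q (n + 1) = Q.getD n 0 := rfl

/-- Prefix invariance of `QV`. -/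
theorem soloInformedQV_append {Q Q' : List ℝ} {n : ℕ} (h : n ≤ Q.length) :
    soloInformedQV (Q ++ Q') n = soloInformedQV Q n := by
  cases n with
  | zero => rfl
  | succ n => simp only [soloInformedQV_succ]; exact List.getD_append _ _ _ _ (by omega)

/-- The last value of `Q ++ [q]` is `q`. -/
theorem soloInformedQV_append_length (Q : List ℝ) (q : ℝ) :
    soloInformedQV (Q ++ [q]) (Q.length + 1) = q := by
  rw [soloInformedQV_succ, List.getD_append_right _ _ _ _ le_rfl, Nat.sub_self, List.getD_cons_zero]

/-- The chain of a word, read with consumption counters `(i, j)`: each step appends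
`QV Q i' · QV R j'` where `(i', j')` are the counters after the step. -/
def soloInformedChainW (Q R : List ℝ) : ℕ → ℕ → List SoloInformedQStep → List ℝ
  | _, _, [] => []
  | i, j, A :: w => (soloInformedQV Q (i + 1) * soloInformedQV R j) :: soloInformedChainW Q R (i + 1) j w
  | i, j, B :: w => (soloInformedQV Q i * soloInformedQV R (j + 1)) :: soloInformedChainW Q R i (j + 1) w
  | i, j, D :: w =>
    (soloInformedQV Q (i + 1) * soloInformedQV R (j + 1)) :: soloInformedChainW Q R (i + 1) (j + 1) w

/-- The open product `G°(c) = ∏ c_t/(1 − c_t)`. -/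
def soloInformedGO (L : List ℝ) : ℝ := (L.map fun a => a / (1 - a)).prod

/-- `G°(()) = 1`. -/
@[simp] theorem soloInformedGO_nil : soloInformedGO [] = 1 := rfl

/-- `G°(L ++ L') = G°(L)·G°(L')`. -/
theorem soloInformedGO_append (L L' : List ℝ) :
    soloInformedGO (L ++ L') = soloInformedGO L * soloInformedGO L' := by
  simp [soloInformedGO, List.map_append, List.prod_append]

/-- `G°([a]) = a/(1−a)`. -/
@[simp] theorem soloInformedGO_single (a : ℝ) : soloInformedGO [a] = a / (1 - a) := by
  simp [soloInformedGO]

/-- `G(L ++ [q]) = G°(L)/(1−q)`. -/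
theorem soloInformedGQ_eq_GO (L : List ℝ) (q : ℝ) :
    soloInformedGQ (L ++ [q]) = soloInformedGO L * (1 / (1 - q)) :=
  soloInformedGQ_append_single L q

/-! ## 2. Structural lemmas for chains -/

/-- **Last-step lemma.** Appending a step appends one entry, computed with the final counters. -/
theorem soloInformed_chainW_snoc (Q R : List ℝ) (s : SoloInformedQStep) :
    ∀ (w : List SoloInformedQStep) (i j : ℕ),
      soloInformedChainW Q R i j (w ++ [s]) =
        soloInformedChainW Q R i j w ++
          soloInformedChainW Q R (i + soloInformedCntA w) (j + soloInformedCntB w) [s]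
  | [], i, j => by simp [soloInformedChainW]
  | s' :: w, i, j => by
    cases s' <;>
      simp only [List.cons_append, soloInformedChainW, soloInformed_chainW_snoc Q R s w,
        soloInformed_cntA_cons, soloInformed_cntB_cons, soloInformedIsA, soloInformedIsB, if_true,
        Bool.false_eq_true, if_false, add_zero, add_assoc, Nat.add_comm (soloInformedCntA w) 1,
        Nat.add_comm (soloInformedCntB w) 1]

/-- Prefix invariance in `Q`. -/
theorem soloInformed_chainW_append_left (Q Q' R : List ℝ) :
    ∀ (w : List SoloInformedQStep) (i j : ℕ), i + soloInformedCntA w ≤ Q.length →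
      soloInformedChainW (Q ++ Q') R i j w = soloInformedChainW Q R i j w
  | [], _, _, _ => rfl
  | s :: w, i, j, h => by
    cases s <;>
      simp only [soloInformed_cntA_cons, soloInformedIsA, if_true, Bool.false_eq_true, if_false,
        add_zero] at h <;>
      simp only [soloInformedChainW, List.cons.injEq]
    · exact ⟨by rw [soloInformedQV_append (by omega)],
        soloInformed_chainW_append_left Q Q' R w _ _ (by omega)⟩
    · exact ⟨by rw [soloInformedQV_append (by omega)],
        soloInformed_chainW_append_left Q Q' R w _ _ (by omega)⟩
    · exact ⟨by rw [soloInformedQV_append (by omega)],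
        soloInformed_chainW_append_left Q Q' R w _ _ (by omega)⟩

/-- Prefix invariance in `R`. -/
theorem soloInformed_chainW_append_right (Q R R' : List ℝ) :
    ∀ (w : List SoloInformedQStep) (i j : ℕ), j + soloInformedCntB w ≤ R.length →
      soloInformedChainW Q (R ++ R') i j w = soloInformedChainW Q R i j w
  | [], _, _, _ => rfl
  | s :: w, i, j, h => by
    cases s <;>
      simp only [soloInformed_cntB_cons, soloInformedIsB, if_true, Bool.false_eq_true, if_false,
        add_zero] at h <;>
      simp only [soloInformedChainW, List.cons.injEq]
    · exact ⟨by rw [soloInformedQV_append (by omega)],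
        soloInformed_chainW_append_right Q R R' w _ _ (by omega)⟩
    · exact ⟨by rw [soloInformedQV_append (by omega)],
        soloInformed_chainW_append_right Q R R' w _ _ (by omega)⟩
    · exact ⟨by rw [soloInformedQV_append (by omega)],
        soloInformed_chainW_append_right Q R R' w _ _ (by omega)⟩

/-- **Entry formula.** The `t`-th entry of the chain is
`QV Q (i + cntA (w.take (t+1))) · QV R (j + cntB (w.take (t+1)))`. -/
theorem soloInformed_chainW_eq_ofFn (Q R : List ℝ) :
    ∀ (w : List SoloInformedQStep) (i j : ℕ),
      soloInformedChainW Q R i j w = List.ofFn fun t : Fin w.length =>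
        soloInformedQV Q (i + soloInformedCntA (w.take ((t : ℕ) + 1))) *
          soloInformedQV R (j + soloInformedCntB (w.take ((t : ℕ) + 1)))
  | [], _, _ => rfl
  | s :: w, i, j => by
    rw [List.length_cons, List.ofFn_succ]
    cases s <;>
      simp only [soloInformedChainW, Fin.val_zero, zero_add, List.take_succ_cons, List.take_zero,
        soloInformed_cntA_cons, soloInformed_cntB_cons, soloInformed_cntA_nil, soloInformed_cntB_nil,
        soloInformedIsA, soloInformedIsB, if_true, Bool.false_eq_true, if_false, add_zero, Fin.val_succ,
        soloInformed_chainW_eq_ofFn Q R w, List.cons.injEq, true_and] <;>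
      (congr 1; funext t; congr 2 <;> omega)

/-- The length of a chain. -/
theorem soloInformed_length_chainW (Q R : List ℝ) (w : List SoloInformedQStep) (i j : ℕ) :
    (soloInformedChainW Q R i j w).length = w.length := by
  rw [soloInformed_chainW_eq_ofFn, List.length_ofFn]

/-! ## 3. The identities -/

section identities

/-- Degenerate decompositions of `QSh 0 (J+1)` and `QSh (K+1) 0` by the last step. -/
theorem soloInformed_sum_qSh_zero_succ {α : Type*} [AddCommMonoid α] (J : ℕ)
    (φ : List SoloInformedQStep → α) :
    ∑ w ∈ soloInformedQSh 0 (J + 1), φ w = ∑ w ∈ soloInformedQSh 0 J, φ (w ++ [B]) := by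
  rw [soloInformed_sum_qSh_zero_left, soloInformed_sum_qSh_zero_left, List.replicate_succ']

/-- Degenerate decompositions of `QSh 0 (J+1)` and `QSh (K+1) 0` by the last step. -/
theorem soloInformed_sum_qSh_succ_zero {α : Type*} [AddCommMonoid α] (K : ℕ)
    (φ : List SoloInformedQStep → α) :
    ∑ w ∈ soloInformedQSh (K + 1) 0, φ w = ∑ w ∈ soloInformedQSh K 0, φ (w ++ [A]) := by
  rw [soloInformed_sum_qSh_zero_right, soloInformed_sum_qSh_zero_right, List.replicate_succ']

/-- The chain of a word of `QSh K J` followed by one more step, over `Q ++ [q]` / `R ++ [r]`. -/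
theorem soloInformed_chainW_snoc_mem {K J : ℕ} {w : List SoloInformedQStep}
    (hw : w ∈ soloInformedQSh K J) (Q R : List ℝ) (s : SoloInformedQStep) :
    soloInformedChainW Q R 0 0 (w ++ [s]) =
      soloInformedChainW Q R 0 0 w ++ soloInformedChainW Q R K J [s] := by
  obtain ⟨hA, hB⟩ := soloInformed_mem_qSh.1 hw
  rw [soloInformed_chainW_snoc, zero_add, zero_add, hA, hB]

/-- The key algebraic identity: `(1 + q/(1−q) + r/(1−r))·qr/(1−qr) = q/(1−q) · r/(1−r)`. -/
theorem soloInformed_GO_step {q r : ℝ} (hq : q < 1) (hr : r < 1) (hqr : q * r < 1) (X Y : ℝ) :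
    (X * (Y * (r / (1 - r))) + X * (q / (1 - q)) * Y + X * Y) * (q * r / (1 - q * r)) =
      X * (q / (1 - q)) * (Y * (r / (1 - r))) := by
  have h1 : 1 - q ≠ 0 := by linarith
  have h2 : 1 - r ≠ 0 := by linarith
  have h3 : 1 - q * r ≠ 0 := by linarith
  have key : r / (1 - r) + q / (1 - q) + 1 = (1 - q * r) / ((1 - q) * (1 - r)) := by
    field_simp
    ring
  calc (X * (Y * (r / (1 - r))) + X * (q / (1 - q)) * Y + X * Y) * (q * r / (1 - q * r))
        = X * Y * ((r / (1 - r) + q / (1 - q) + 1) * (q * r / (1 - q * r))) := by ring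
    _ = X * Y * (q * r / ((1 - q) * (1 - r))) := by
      rw [key, div_mul_div_comm, mul_comm (1 - q * r) (q * r), mul_div_mul_right _ _ h3]
    _ = X * (q / (1 - q)) * (Y * (r / (1 - r))) := by rw [← div_mul_div_comm]; ring

/-- **`Σ_{w ∈ QSh K J} G°(chain_w) = G°(Q)·G°(R)`** for chains with entries in `[0,1)`. -/
theorem soloInformed_sum_GO_chainW : ∀ (K J : ℕ) (Q R : List ℝ), Q.length = K → R.length = J →
    (∀ q ∈ Q, 0 ≤ q ∧ q < 1) → (∀ r ∈ R, 0 ≤ r ∧ r < 1) →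
      ∑ w ∈ soloInformedQSh K J, soloInformedGO (soloInformedChainW Q R 0 0 w) =
        soloInformedGO Q * soloInformedGO R := by
  intro K
  induction K with
  | zero =>
    intro J
    induction J with
    | zero =>
      intro Q R hQ hR _ _
      rw [List.length_eq_zero_iff.1 hQ, List.length_eq_zero_iff.1 hR, soloInformed_sum_qSh_zero_left]
      simp [soloInformedChainW]
    | succ J ihJ =>
      intro Q R hQ hR hQ1 hR1
      obtain rfl := List.length_eq_zero_iff.1 hQ
      have hne : R ≠ [] := by rintro rfl; simp at hR
      obtain ⟨R₁, r, rfl⟩ : ∃ R₁ r, R = R₁ ++ [r] := ⟨_, _, (List.dropLast_append_getLast hne).symm⟩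
      rw [List.length_append, List.length_singleton, Nat.add_right_cancel_iff] at hR
      rw [soloInformed_sum_qSh_zero_succ]
      have hR1' : ∀ x ∈ R₁, 0 ≤ x ∧ x < 1 := fun x hx => hR1 x (List.mem_append_left _ hx)
      have step : ∀ w ∈ soloInformedQSh 0 J,
          soloInformedGO (soloInformedChainW [] (R₁ ++ [r]) 0 0 (w ++ [B])) =
            soloInformedGO (soloInformedChainW [] R₁ 0 0 w) * (r / (1 - r)) := by
        intro w hw
        rw [soloInformed_chainW_snoc_mem hw, soloInformedGO_append,
          soloInformed_chainW_append_right [] R₁ [r] w 0 0 (by rw [(soloInformed_mem_qSh.1 hw).2, hR]; omega)]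
        simp [soloInformedChainW, ← hR]
      rw [Finset.sum_congr rfl step, ← Finset.sum_mul, ihJ [] R₁ hQ hR hQ1 hR1', soloInformedGO_append,
        soloInformedGO_single, mul_assoc]
  | succ K ihK =>
    intro J
    induction J with
    | zero =>
      intro Q R hQ hR hQ1 hR1
      obtain rfl := List.length_eq_zero_iff.1 hR
      have hne : Q ≠ [] := by rintro rfl; simp at hQ
      obtain ⟨Q₁, q, rfl⟩ : ∃ Q₁ q, Q = Q₁ ++ [q] := ⟨_, _, (List.dropLast_append_getLast hne).symm⟩
      rw [List.length_append, List.length_singleton, Nat.add_right_cancel_iff] at hQ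
      rw [soloInformed_sum_qSh_succ_zero]
      have hQ1' : ∀ x ∈ Q₁, 0 ≤ x ∧ x < 1 := fun x hx => hQ1 x (List.mem_append_left _ hx)
      have step : ∀ w ∈ soloInformedQSh K 0,
          soloInformedGO (soloInformedChainW (Q₁ ++ [q]) [] 0 0 (w ++ [A])) =
            soloInformedGO (soloInformedChainW Q₁ [] 0 0 w) * (q / (1 - q)) := by
        intro w hw
        rw [soloInformed_chainW_snoc_mem hw, soloInformedGO_append,
          soloInformed_chainW_append_left Q₁ [q] [] w 0 0 (by rw [(soloInformed_mem_qSh.1 hw).1, hQ]; omega)]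
        simp [soloInformedChainW, ← hQ]
      rw [Finset.sum_congr rfl step, ← Finset.sum_mul, ihK 0 Q₁ [] hQ hR hQ1' hR1, soloInformedGO_append,
        soloInformedGO_single]
      ring
    | succ J ihJ =>
      intro Q R hQ hR hQ1 hR1
      have hneQ : Q ≠ [] := by rintro rfl; simp at hQ
      have hneR : R ≠ [] := by rintro rfl; simp at hR
      obtain ⟨Q₁, q, rfl⟩ : ∃ Q₁ q, Q = Q₁ ++ [q] := ⟨_, _, (List.dropLast_append_getLast hneQ).symm⟩
      obtain ⟨R₁, r, rfl⟩ : ∃ R₁ r, R = R₁ ++ [r] := ⟨_, _, (List.dropLast_append_getLast hneR).symm⟩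
      rw [List.length_append, List.length_singleton, Nat.add_right_cancel_iff] at hQ hR
      have hQ1' : ∀ x ∈ Q₁, 0 ≤ x ∧ x < 1 := fun x hx => hQ1 x (List.mem_append_left _ hx)
      have hR1' : ∀ x ∈ R₁, 0 ≤ x ∧ x < 1 := fun x hx => hR1 x (List.mem_append_left _ hx)
      have hq := hQ1 q (by simp)
      have hr := hR1 r (by simp)
      have hqr : q * r < 1 := mul_lt_one_of_nonneg_of_lt_one_left hq.1 hq.2 hr.2.le
      have hq' : soloInformedQV (Q₁ ++ [q]) (K + 1) = q := by rw [← hQ, soloInformedQV_append_length]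
      have hr' : soloInformedQV (R₁ ++ [r]) (J + 1) = r := by rw [← hR, soloInformedQV_append_length]
      have eA : ∀ w ∈ soloInformedQSh K (J + 1),
          soloInformedGO (soloInformedChainW (Q₁ ++ [q]) (R₁ ++ [r]) 0 0 (w ++ [A])) =
            soloInformedGO (soloInformedChainW Q₁ (R₁ ++ [r]) 0 0 w) * (q * r / (1 - q * r)) := by
        intro w hw
        rw [soloInformed_chainW_snoc_mem hw, soloInformedGO_append,
          soloInformed_chainW_append_left Q₁ [q] (R₁ ++ [r]) w 0 0
            (by rw [(soloInformed_mem_qSh.1 hw).1, hQ]; omega)]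
        simp only [soloInformedChainW, hq', hr', soloInformedGO_single]
      have eB : ∀ w ∈ soloInformedQSh (K + 1) J,
          soloInformedGO (soloInformedChainW (Q₁ ++ [q]) (R₁ ++ [r]) 0 0 (w ++ [B])) =
            soloInformedGO (soloInformedChainW (Q₁ ++ [q]) R₁ 0 0 w) * (q * r / (1 - q * r)) := by
        intro w hw
        rw [soloInformed_chainW_snoc_mem hw, soloInformedGO_append,
          soloInformed_chainW_append_right (Q₁ ++ [q]) R₁ [r] w 0 0
            (by rw [(soloInformed_mem_qSh.1 hw).2, hR]; omega)]
        simp only [soloInformedChainW, hq', hr', soloInformedGO_single]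
      have eD : ∀ w ∈ soloInformedQSh K J,
          soloInformedGO (soloInformedChainW (Q₁ ++ [q]) (R₁ ++ [r]) 0 0 (w ++ [D])) =
            soloInformedGO (soloInformedChainW Q₁ R₁ 0 0 w) * (q * r / (1 - q * r)) := by
        intro w hw
        rw [soloInformed_chainW_snoc_mem hw, soloInformedGO_append,
          soloInformed_chainW_append_left Q₁ [q] (R₁ ++ [r]) w 0 0
            (by rw [(soloInformed_mem_qSh.1 hw).1, hQ]; omega),
          soloInformed_chainW_append_right Q₁ R₁ [r] w 0 0
            (by rw [(soloInformed_mem_qSh.1 hw).2, hR]; omega)]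
        simp only [soloInformedChainW, hq', hr', soloInformedGO_single]
      rw [soloInformed_sum_qSh_snoc, Finset.sum_congr rfl eA, Finset.sum_congr rfl eB,
        Finset.sum_congr rfl eD, ← Finset.sum_mul, ← Finset.sum_mul, ← Finset.sum_mul,
        ihK (J + 1) Q₁ (R₁ ++ [r]) hQ (by simp [hR]) hQ1' hR1,
        ihJ (Q₁ ++ [q]) R₁ (by simp [hQ]) hR hQ1 hR1', ihK J Q₁ R₁ hQ hR hQ1' hR1',
        soloInformedGO_append, soloInformedGO_append, soloInformedGO_single, soloInformedGO_single,
        ← add_mul, ← add_mul]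
      exact soloInformed_GO_step hq.2 hr.2 hqr _ _

/-- The closed-chain step: `(1 + q/(1−q) + r/(1−r)) · 1/(1−qr) = 1/(1−q) · 1/(1−r)`. -/
theorem soloInformed_GQ_step {q r : ℝ} (hq : q < 1) (hr : r < 1) (hqr : q * r < 1) (X Y : ℝ) :
    (X * (Y * (r / (1 - r))) + X * (q / (1 - q)) * Y + X * Y) * (1 / (1 - q * r)) =
      X * (1 / (1 - q)) * (Y * (1 / (1 - r))) := by
  have h1 : 1 - q ≠ 0 := by linarith
  have h2 : 1 - r ≠ 0 := by linarith
  have h3 : 1 - q * r ≠ 0 := by linarith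
  have key : r / (1 - r) + q / (1 - q) + 1 = (1 - q * r) / ((1 - q) * (1 - r)) := by
    field_simp
    ring
  calc (X * (Y * (r / (1 - r))) + X * (q / (1 - q)) * Y + X * Y) * (1 / (1 - q * r))
        = X * Y * ((r / (1 - r) + q / (1 - q) + 1) * (1 / (1 - q * r))) := by ring
    _ = X * Y * (1 / ((1 - q) * (1 - r))) := by
      rw [key, div_mul_div_comm, mul_one, mul_comm ((1 - q) * (1 - r)) (1 - q * r),
        div_mul_cancel_left₀ h3, inv_eq_one_div]
    _ = X * (1 / (1 - q)) * (Y * (1 / (1 - r))) := by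
      rw [show (1 : ℝ) / ((1 - q) * (1 - r)) = 1 / (1 - q) * (1 / (1 - r)) by
        rw [div_mul_div_comm, one_mul]]
      ring

/-- **THE TWO-CHAIN IDENTITY: `Σ_{w ∈ QSh (K+1) (J+1)} G(chain_w) = G(Q)·G(R)`** for nonempty
chains with entries in `[0,1)` — the rational form of Hoffman's harmonic product of nested sums.
[Hoffman 1997 §2; Hoffman 2000 §2] -/
theorem soloInformed_sum_GQ_chainW (K J : ℕ) (Q R : List ℝ) (hQ : Q.length = K + 1)
    (hR : R.length = J + 1) (hQ1 : ∀ q ∈ Q, 0 ≤ q ∧ q < 1) (hR1 : ∀ r ∈ R, 0 ≤ r ∧ r < 1) :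
    ∑ w ∈ soloInformedQSh (K + 1) (J + 1), soloInformedGQ (soloInformedChainW Q R 0 0 w) =
      soloInformedGQ Q * soloInformedGQ R := by
  have hneQ : Q ≠ [] := by rintro rfl; simp at hQ
  have hneR : R ≠ [] := by rintro rfl; simp at hR
  obtain ⟨Q₁, q, rfl⟩ : ∃ Q₁ q, Q = Q₁ ++ [q] := ⟨_, _, (List.dropLast_append_getLast hneQ).symm⟩
  obtain ⟨R₁, r, rfl⟩ : ∃ R₁ r, R = R₁ ++ [r] := ⟨_, _, (List.dropLast_append_getLast hneR).symm⟩
  rw [List.length_append, List.length_singleton, Nat.add_right_cancel_iff] at hQ hR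
  have hQ1' : ∀ x ∈ Q₁, 0 ≤ x ∧ x < 1 := fun x hx => hQ1 x (List.mem_append_left _ hx)
  have hR1' : ∀ x ∈ R₁, 0 ≤ x ∧ x < 1 := fun x hx => hR1 x (List.mem_append_left _ hx)
  have hq := hQ1 q (by simp)
  have hr := hR1 r (by simp)
  have hqr : q * r < 1 := mul_lt_one_of_nonneg_of_lt_one_left hq.1 hq.2 hr.2.le
  have hq' : soloInformedQV (Q₁ ++ [q]) (K + 1) = q := by rw [← hQ, soloInformedQV_append_length]
  have hr' : soloInformedQV (R₁ ++ [r]) (J + 1) = r := by rw [← hR, soloInformedQV_append_length]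
  have eA : ∀ w ∈ soloInformedQSh K (J + 1),
      soloInformedGQ (soloInformedChainW (Q₁ ++ [q]) (R₁ ++ [r]) 0 0 (w ++ [A])) =
        soloInformedGO (soloInformedChainW Q₁ (R₁ ++ [r]) 0 0 w) * (1 / (1 - q * r)) := by
    intro w hw
    rw [soloInformed_chainW_snoc_mem hw,
      soloInformed_chainW_append_left Q₁ [q] (R₁ ++ [r]) w 0 0
        (by rw [(soloInformed_mem_qSh.1 hw).1, hQ]; omega)]
    simp only [soloInformedChainW, hq', hr', soloInformedGQ_eq_GO]
  have eB : ∀ w ∈ soloInformedQSh (K + 1) J,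
      soloInformedGQ (soloInformedChainW (Q₁ ++ [q]) (R₁ ++ [r]) 0 0 (w ++ [B])) =
        soloInformedGO (soloInformedChainW (Q₁ ++ [q]) R₁ 0 0 w) * (1 / (1 - q * r)) := by
    intro w hw
    rw [soloInformed_chainW_snoc_mem hw,
      soloInformed_chainW_append_right (Q₁ ++ [q]) R₁ [r] w 0 0
        (by rw [(soloInformed_mem_qSh.1 hw).2, hR]; omega)]
    simp only [soloInformedChainW, hq', hr', soloInformedGQ_eq_GO]
  have eD : ∀ w ∈ soloInformedQSh K J,
      soloInformedGQ (soloInformedChainW (Q₁ ++ [q]) (R₁ ++ [r]) 0 0 (w ++ [D])) =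
        soloInformedGO (soloInformedChainW Q₁ R₁ 0 0 w) * (1 / (1 - q * r)) := by
    intro w hw
    rw [soloInformed_chainW_snoc_mem hw,
      soloInformed_chainW_append_left Q₁ [q] (R₁ ++ [r]) w 0 0
        (by rw [(soloInformed_mem_qSh.1 hw).1, hQ]; omega),
      soloInformed_chainW_append_right Q₁ R₁ [r] w 0 0
        (by rw [(soloInformed_mem_qSh.1 hw).2, hR]; omega)]
    simp only [soloInformedChainW, hq', hr', soloInformedGQ_eq_GO]
  rw [soloInformed_sum_qSh_snoc, Finset.sum_congr rfl eA, Finset.sum_congr rfl eB,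
    Finset.sum_congr rfl eD, ← Finset.sum_mul, ← Finset.sum_mul, ← Finset.sum_mul,
    soloInformed_sum_GO_chainW K (J + 1) Q₁ (R₁ ++ [r]) hQ (by simp [hR]) hQ1' hR1,
    soloInformed_sum_GO_chainW (K + 1) J (Q₁ ++ [q]) R₁ (by simp [hQ]) hR hQ1 hR1',
    soloInformed_sum_GO_chainW K J Q₁ R₁ hQ hR hQ1' hR1',
    soloInformedGO_append, soloInformedGO_append, soloInformedGO_single, soloInformedGO_single,
    ← add_mul, ← add_mul, soloInformedGQ_eq_GO, soloInformedGQ_eq_GO]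
  exact soloInformed_GQ_step hq.2 hr.2 hqr _ _

/-- Example: `|QSh 1 1| = 3` — `G(q)G(r) = G(q,qr) + G(r,qr) + G(qr)`, the depth-one stuffle. -/
example : (soloInformedQSh 1 1).card = 3 := by decide

end identities

end Summit.KontsevichZagierPeriods.KontsevichZagierPeriods.Theorems
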